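import Literature.AlgebraicGeometry.Resolution.NormalCrossingWithHasSNC
import Literature.AlgebraicGeometry.Resolution.TransversalHasSNCWith
import Literature.AlgebraicGeometry.Resolution.PointCentrePermissible
import HarnessLib

/-!
# Blowing up a closed point of a strict normal crossings divisor keeps strict normal crossings
# (The Stacks Project, Lemma 54.15.6 = Tag 0BIC, proof ¶1; Kollár 2007, Def. 3.25)

Topic: `Literature/AlgebraicGeometry/Resolution`. Theorem-only file (sorry-free, no definitions, no
named facts), a brick toward the discharge of the named fact F-75c
`Stacks0BIC_embeddedResolutionCurvesInSurfaces_locus` (`EmbeddedResolutionCurvesInSurfaces.lean`).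

In the proof of Stacks Lemma 54.15.6 (Tag 0BIC) one blows up closed points `p` of a configuration
`Z` of curves on a regular surface again and again; once the configuration is a strict normal crossings
divisor, further point blow-ups at points OF the divisor do not destroy this («in each blowup of a point
of `Z` we add a new irreducible component to `Z`, namely the exceptional divisor» — which is regular and
crosses the strict transforms normally). The tree proves the persistence of simple normal crossings under
blow-ups whose centre has simple normal crossings WITH the boundary list (`HasSNCWith.hasSNC_transform`,
`BlowupSNC.lean`; Kollár 2007, Def. 3.25) and the passage between de Jong's closed-subset idiom
`IsStrictNormalCrossingsDivisor` and the list idiom (`IsStrictNormalCrossingsDivisor.exists_hasSNC`,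
`HasSNC.isStrictNormalCrossingsDivisor_biUnion_support`). Here:

* `isNormalCrossingWith_singleton_of_mem` — a closed point `x ∈ B` of a strict normal crossings divisor
  `B` is normal crossing with `B` (CJS Def. 4.1: `I({x})_x = 𝔪_x` is spanned by the whole regular system
  of parameters `(x₁,…,x_r,y₁,…,y_e)` of the snc chart, `I(B)_x = (x₁ ⋯ x_r)`);
* `IsStrictNormalCrossingsDivisor.isRegular_and_preimage_of_isBlowup_singleton` — **for a regular
  Noetherian scheme `Z`, a strict normal crossings divisor `B ⊆ Z`, a closed point `x ∈ B` and a blowing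
  up `π : Z' → Z` of `Z` in `x` (universal property, centre the reduced point `𝓘_{x}`): `Z'` is regular
  and `π⁻¹(B)` is a strict normal crossings divisor on `Z'`.**

AI-written from the tree's bricks; weaker than expert review. Not a statement of [Hironaka2017].

## References
* The Stacks Project, Tag 0BIC (Lemma 54.15.6, proof ¶1), Tag 0BIA. [StacksProject]
* J. Kollár, *Lectures on Resolution of Singularities* (2007), Def. 3.25. [Kollar2007]
* V. Cossart, U. Jannsen, S. Saito, LNM 2270 (2020), Def. 4.1. [CossartJannsenSaito2020]
-/

noncomputable section

open CategoryTheory AlgebraicGeometry TopologicalSpace IsLocalRing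

universe u

namespace Literature.AlgebraicGeometry.Resolution

open Scheme.IdealSheafData

/-- `range (Fin.append u v) = range u ∪ range v`. [folklore] -/
private theorem range_fin_append_eq {α : Type*} {m n : ℕ} (u : Fin m → α) (v : Fin n → α) :
    Set.range (Fin.append u v) = Set.range u ∪ Set.range v := by
  ext a
  constructor
  · rintro ⟨i, rfl⟩
    induction i using Fin.addCases with
    | left i => exact Or.inl ⟨i, by simp⟩
    | right i => exact Or.inr ⟨i, by simp⟩
  · rintro (⟨i, rfl⟩ | ⟨i, rfl⟩)
    · exact ⟨Fin.castAdd n i, by simp⟩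
    · exact ⟨Fin.natAdd m i, by simp⟩

variable {Z Z' : Scheme.{u}} {π : Z' ⟶ Z}

/-- **A closed point of a strict normal crossings divisor is normal crossing with it** (CJS Def. 4.1,
with `J₁ =` the divisor block, `J₂ = ∅`): at `x`, the snc chart `(x₁,…,x_r ; y₁,…,y_e)` of `B` is a
regular system of parameters spanning `I({x})_x = 𝔪_x`, and `I(B)_x = (∏ xᵢ)`.
[cite: CossartJannsenSaito2020, Def. 4.1] [cite: StacksProject, Tag 0BI9] -/
theorem isNormalCrossingWith_singleton_of_mem {B : Set Z} (hB : IsStrictNormalCrossingsDivisor Z B)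
    {x : Z} (hx : IsClosed ({x} : Set Z)) (hxB : x ∈ B) :
    IsNormalCrossingWith Z ({x} : Set Z) B := by
  classical
  intro p hp
  obtain rfl : p = x := hp
  obtain ⟨hreg, r, e, xs, ys, -, hdim, hspan, hI⟩ :=
    ((isStrictNormalCrossingsDivisor_iff_stalkIdeal Z B).1 hB).2 p hxB
  -- the whole chart as the `z`-block, empty `w`-block
  refine ⟨hreg, r + e, 0, Fin.append xs ys, Fin.elim0, Finset.univ.filter (fun i => (i : ℕ) < r), ∅,
    by simpa using hdim, ?_, ?_, ?_⟩
  · -- span: `range (append xs ys) ∪ range elim0 = range xs ∪ range ys`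
    have h0 : Set.range (Fin.elim0 : Fin 0 → Z.presheaf.stalk p) = ∅ := Set.range_eq_empty _
    rw [range_fin_append_eq, h0, Set.union_empty, hspan]
  · -- `I({x})_x = 𝔪_x = span of the chart`
    have hcl : (⟨closure {p}, isClosed_closure⟩ : Closeds Z) = ⟨{p}, hx⟩ := Closeds.ext hx.closure_eq
    rw [hcl, stalkIdeal_vanishingIdeal_singleton hx, ← hspan, range_fin_append_eq]
  · -- `I(B)_x = ∏ xs = ∏ over the first block`
    rw [hI, Finset.prod_empty, mul_one]
    congr 1
    -- `∏ i, xs i = ∏ i ∈ filter (< r), append xs ys i`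
    rw [show (Finset.univ.filter fun i : Fin (r + e) => (i : ℕ) < r) =
        (Finset.univ : Finset (Fin r)).map (Fin.castAddEmb e) by
      ext i
      simp only [Finset.mem_filter, Finset.mem_univ, true_and, Finset.mem_map, Fin.castAddEmb_apply]
      constructor
      · intro hi
        exact ⟨⟨i, hi⟩, by ext; simp⟩
      · rintro ⟨j, rfl⟩
        simp]
    rw [Finset.prod_map]
    simp

/-- **Blowing up a closed point of a strict normal crossings divisor on a regular Noetherian scheme
keeps regularity and strict normal crossings** (Stacks 0BIC, proof ¶1: the inverse image of the
configuration is the strict transform plus the exceptional divisor, again snc; Kollár 2007, Def. 3.25):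
for `B ⊆ Z` snc, `x ∈ B` a closed point and `π : Z' → Z` a blowing up in `x`, the scheme `Z'` is
regular and `π⁻¹(B)` is a strict normal crossings divisor on `Z'`.
[cite: StacksProject, Tag 0BIC (Lemma 54.15.6, proof ¶1)] [cite: Kollar2007, Def. 3.25] -/
theorem IsStrictNormalCrossingsDivisor.isRegular_and_preimage_of_isBlowup_singleton [IsNoetherian Z]
    (hZ : Scheme.IsRegular Z) {B : Set Z} (hB : IsStrictNormalCrossingsDivisor Z B) {x : Z}
    (hx : IsClosed ({x} : Set Z)) (hxB : x ∈ B) (hπ : IsBlowup π (vanishingIdeal ⟨{x}, hx⟩)) :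
    Scheme.IsRegular Z' ∧ IsStrictNormalCrossingsDivisor Z' (π ⁻¹' B) := by
  obtain ⟨E, hE, -, -, hEB⟩ := hB.exists_hasSNC hZ
  have hnc : IsNormalCrossingWith Z (((vanishingIdeal ⟨{x}, hx⟩).support : Closeds Z) : Set Z) B := by
    rw [coe_support_vanishingIdeal]
    exact isNormalCrossingWith_singleton_of_mem hB hx hxB
  have hC : HasSNCWith E (vanishingIdeal ⟨{x}, hx⟩) :=
    IsNormalCrossingWith.hasSNCWith_of_hasSNC_of_isRegular hE hEB.subset
      (isRegular_subscheme_vanishingIdeal_singleton hx) hnc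
  haveI : IsProper π := hπ.isProper
  haveI : IsLocallyNoetherian Z' := LocallyOfFiniteType.isLocallyNoetherian π
  have h' := hC.hasSNC_transform hπ
  refine ⟨fun x' => (h' x').1, ?_⟩
  have hU := biUnion_support_transform_eq π (vanishingIdeal ⟨{x}, hx⟩) E
  have hxB' : (((vanishingIdeal ⟨{x}, hx⟩).support : Closeds Z) : Set Z) ∪ B = B := by
    rw [coe_support_vanishingIdeal]
    exact Set.union_eq_self_of_subset_left (Set.singleton_subset_iff.mpr hxB)
  rw [hEB, hxB'] at hU
  rw [← hU]
  exact h'.isStrictNormalCrossingsDivisor_biUnion_support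

end Literature.AlgebraicGeometry.Resolution

end
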